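import Summits.QuantumFields.BalabanUV.Gaps.D1PinnedNumeral
import Summits.QuantumFields.BalabanUV.Gaps.D1PinnedLimitClosedForm
import Summits.QuantumFields.BalabanUV.Gaps.D1PinnedClosedFormHalves

/-!
# `BalabanUV.Gaps.D1PinnedNumeralClosedForm` — cell pub-balaban-gaps, row (D1), seat g1-p1: the numeral statements of `Gaps/D1PinnedNumeral` at the pinned
# literal `JsBalAn1`, RE-READ ON THE CLOSED-FORM LIMIT `M∞` through the bridge `Gaps/D1PinnedLimitClosedForm.lim_eq_closedForm_pinned` (`CauchyRate.lim β⁰ = M∞`):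
# `(∃ N, D1Drift …) ↔ 0 ≤ M∞`; `N_eff = √(12π²·M∞ ∕ (11·log Lc))` in closed form; uniqueness; `(∃ N > 0, D1Drift …) ↔ 0 < M∞` (also at the centred root);
# and, with `Gaps/D1PinnedClosedFormHalves`, the limit on its two words: `CauchyRate.lim β⁰ = M∞ᵂ + M∞ˢ` (tadpole half + bubble half)

HONEST FRAMING (cell rule, page 1 of everything): bookkeeping BY NAME over tree theorems — gan24-p1's hypothesis-free rows for the pinned literal
(`GAN24.WSlotT2TablesAn1.hW_hWall_three_an1At_pinned`, `GAN24.StencilSlotSAllThree.hS_hSall_three`, `GAN24.KSlotAssembly.convCKWall_holds`, merged by asym1's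
`HessKerConvCKPlug.exists_merged_rows`), asym1's unit-covariant LIMIT-currency socket `HessKerDressedUnitsWall.geomRate_secondMoment_TbalOf_JsBalOf_lim_unit` at the
CONSTRUCTED limits (`HessKerDressedLimit.decays_limMKerOf` ∕ `locStencil_limStOf` ∕ `vertexFamily₂_limTabOf` and their rate twins), Mathlib's uniqueness of limits
(`Filter.Tendsto.limUnder_eq`), and g1-p3's pinned files `Gaps/CapTailPinnedLimitSign` ∕ `Gaps/CapTailEndNecessity`.  NOTHING of Bałaban's is asserted beyond print;
[Balaban1987RG1] Thm 2 is UNPROVED IN PRINT; the VALUE of `M∞` is NOT computed here (that computation — `M∞ = (11N²∕12π²)·log Lc` for Bałaban's colour data — IS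
the wall (D1) at this literal, the β sub-cell's identification `hident` ∕ road A2's «second half») and its SIGN is NOT decided here; the family `JsBalAn1 …` does NOT depend on the numeral `N` and its colour
data `cE cVH cΛ cB Tc` are free reals ∕ a free table ((P6), pinned last); 0 coefficients certified; (D1) NOT discharged at any literal; 0∕4 row-D1 binders; NOT
`BetaPertH`, NOT the continuum limit, NOT Clay.  HONEST DEPENDENCY (b2b cell, verbatim): «continuum YM on T⁴ ⇐ BetaPertH ∧ nine spine estimates (0/9 proved);
BetaPertH ⇐ (D1) ∧ (D4) ∧ CAP+tail; G-an2-4 gates asym, D1 and NE2/3/4.»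

CONTENT (all [folklore]; no `def`, no `def … : Prop`, nothing cited as a hypothesis, 0 sorry; `2 ≤ Lc`, root `r ∈ box 4 Lc`, any colour data, any channel; every proof
is `rw [← lim_eq_closedForm_pinned]` + the `D1PinnedNumeral` statement BY NAME):
**`exists_numeral_iff_closedForm_nonneg`** (`(∃ N, D1Drift Lc (JsBalAn1 …) N μ ν) ↔ 0 ≤ M∞`), **`d1Drift_pinned_iff_eq_sqrt_closedForm`**
(`0 ≤ N → (D1Drift … N ↔ 0 ≤ M∞ ∧ N = √(12π²·M∞ ∕ (11·log Lc)))` — THE BINDER's ONE FREE PARAMETER AT THE LITERAL AS AN EXPLICIT FUNCTIONAL OF THE CONSTRUCTED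
LIMIT PRIMITIVES), **`existsUnique_numeral_of_closedForm_nonneg`**, **`exists_pos_numeral_iff_closedForm_pos`** (`(∃ N, 0 < N ∧ D1Drift …) ↔ 0 < M∞` — the END's
β⁰-side bit «(D1) for SOME positive numeral» is the strict sign of `M∞`), and at the CENTRED root (road BF-x's literal `JsBalAn1Ctr`, `rfl`-instance)
**`exists_pos_numeral_iff_closedForm_pos_ctr`**; §3 **`lim_eq_halves_pinned`** — `CauchyRate.lim (j ↦ β⁰_j) = secondMoment (hessKer A∞ 0 W∞) μ ν +
secondMoment (hessKer A∞ V∞ 0) μ ν` (the bridge ∘ `D1PinnedClosedFormHalves.closedForm_eq_halves_pinned`): the number the END reads, on its tadpole and bubble words.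
READING (zero classification weight): the VALUE content of (D1) at the pinned literal is `N_eff(M∞) = N`, i.e. `M∞ = (11N²∕12π²)·log Lc` — gan24-p1's
identification, untouched; the headline consumes `0 < M∞` only (`D1PinnedLimitClosedForm` §2).

ABSOLUTE RULE (cell charter, verbatim): «No internally-minted statement may enter as a cited fact. Every hypothesis is either kernel-proved in this
package or a verbatim quotation of a PUBLISHED theorem with page reference. The manuscript(s) under audit are NOT citable for their own disputed
steps — they are the thing under adjudication; programme-internal (2001/route/tribunal) claims are never citable.»

Provenance: cell pub-balaban-gaps, seat g1-p1 GEN 9 (prover-pub-balaban-gaps-g1-p1-g9-0), 2026-08-23; imports this lineage's `Gaps/D1PinnedNumeral` (p367301),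
`Gaps/D1PinnedLimitClosedForm` and `Gaps/D1PinnedClosedFormHalves` ONLY; every tree theorem used BY NAME; no existing file touched.
-/

noncomputable section

open Finset Filter Topology
open scoped BigOperators
open Literature.MathematicalPhysics.QuantumFieldTheory
open Literature.MathematicalPhysics.QuantumFieldTheory.Balaban1983to89
open Literature.MathematicalPhysics.QuantumFieldTheory.Balaban1983to89.FlowStep
open Literature.MathematicalPhysics.QuantumFieldTheory.Balaban1983to89.FlowStepRuns
open Literature.MathematicalPhysics.QuantumFieldTheory.Balaban1983to89.DagBinding
open Literature.MathematicalPhysics.QuantumFieldTheory.Balaban1983to89.Beta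
open AffineAveraging (box toSite)
open AveragingContoursRooted (ctrOff ctrOff_mem_box)
open ExpKernelCalculus (MKer VertexFamily₂ hessKer)
open OneStepResolventKernel (Fib LocStencil)
open OneStepKernelFamily (KInvStep D1Drift TbalOf)
open RemainderConstAllScales (AllScalesSeq)
open RateCertificate (GeomRate CauchyRate)
open AxialDressing (axDressK axVertexOfK)
open BalabanStepJetsSucc (JsBal0Of JsBalOf)
open BalabanStepW2 (T2Of T2Of_loc CwOf δwOf δwOf_pos WbalOf_loc₂ WbalOf)
open AveragingMixedJetTables (vh₂SAt mixFFAt)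
open HessKerDressedLimit (limMKerOf limStOf limTabOf decays_limMKerOf decays_sub_limMKerOf locStencil_limStOf locStencil_sub_limStOf
  vertexFamily₂_limTabOf vertexFamily₂_sub_limTabOf)
open Summit.QuantumFields.BalabanUV.Beta.HessKerDressedUnits (unitK unitS unitW)
open Summit.QuantumFields.BalabanUV.Beta.MixedJetTablesPlug (hmix_an1 hB_an1 JsBalAn1 JsBalAn1Ctr)
open Summit.QuantumFields.BalabanUV.Beta.GAN24.CombesThomas (sfStep smStep sfStep_ne_zero smStep_ne_zero)
open Summit.QuantumFields.BalabanUV.Beta.GAN24.StencilSlotOfE3 (one_le_of_two_le)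
open Summit.QuantumFields.BalabanUV.Gaps.D1PinnedNumeral (exists_numeral_iff_lim_nonneg d1Drift_pinned_iff_eq_sqrt existsUnique_numeral_of_lim_nonneg
  exists_pos_numeral_iff_lim_pos)
open Summit.QuantumFields.BalabanUV.Gaps.D1PinnedLimitClosedForm (lim_eq_closedForm_pinned)
open Summit.QuantumFields.BalabanUV.Gaps.D1PinnedClosedFormHalves (closedForm_eq_halves_pinned)
open Real

namespace Summit.QuantumFields.BalabanUV.Gaps.D1PinnedNumeralClosedForm

variable {Lc : ℕ} [NeZero Lc] {r : Fin (3 + 1) → ℕ}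

/-! ## §1 Existence of a numeral, `N_eff` in closed form, uniqueness, the positive-numeral bit — on `M∞` -/

/-- [folklore] **(D1) AT THE PINNED LITERAL FOR SOME NUMERAL ⟺ `0 ≤ M∞`** (`D1PinnedNumeral.exists_numeral_iff_lim_nonneg` across the bridge). -/
theorem exists_numeral_iff_closedForm_nonneg (hLc : 2 ≤ Lc) (hr : r ∈ box (3 + 1) Lc) (cE cVH cΛ cB : ℝ)
    (Tc : Fin 4 → Fin 4 → Fin 4 → Fin 4 → ℝ) (μ ν : Fin 4) :
    (∃ N : ℝ, D1Drift Lc (JsBalAn1 (one_le_of_two_le hLc) hr cE cVH cΛ ((Lc : ℝ) ^ (2 * (3 + 1))) cB Tc) N μ ν) ↔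
      0 ≤ B12Beta.secondMoment (hessKer (axDressK Lc (limMKerOf fun j => unitK (sfStep Lc j) (smStep 3 Lc j) (KInvStep (d := 3) Lc j)))
        (axVertexOfK (limMKerOf fun j => unitK (sfStep Lc j) (smStep 3 Lc j) (KInvStep (d := 3) Lc j)) Lc
          (limStOf fun j => unitS (sfStep Lc j) (smStep 3 Lc j) (JsBal0Of (one_le_of_two_le hLc) cE cVH cΛ (WbalOf 3 Lc cE cVH cΛ (T2Of 3 Lc cE cVH cΛ ((Lc : ℝ) ^ (2 * (3 + 1))) cB Tc (vh₂SAt (toSite r) Lc) (mixFFAt (toSite r) Lc)) (mixFFAt (toSite r) Lc))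
            (CwOf (one_le_of_two_le hLc) cE cVH cΛ (T2Of_loc (one_le_of_two_le hLc) cE cVH cΛ ((Lc : ℝ) ^ (2 * (3 + 1))) cB Tc (hB_an1 (one_le_of_two_le hLc) hr) (hmix_an1 (one_le_of_two_le hLc) hr)) (hmix_an1 (one_le_of_two_le hLc) hr)) (δwOf (one_le_of_two_le hLc) cE cVH cΛ (T2Of_loc (one_le_of_two_le hLc) cE cVH cΛ ((Lc : ℝ) ^ (2 * (3 + 1))) cB Tc (hB_an1 (one_le_of_two_le hLc) hr) (hmix_an1 (one_le_of_two_le hLc) hr)) (hmix_an1 (one_le_of_two_le hLc) hr))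
            (δwOf_pos (one_le_of_two_le hLc) cE cVH cΛ (T2Of_loc (one_le_of_two_le hLc) cE cVH cΛ ((Lc : ℝ) ^ (2 * (3 + 1))) cB Tc (hB_an1 (one_le_of_two_le hLc) hr) (hmix_an1 (one_le_of_two_le hLc) hr)) (hmix_an1 (one_le_of_two_le hLc) hr)) (WbalOf_loc₂ (one_le_of_two_le hLc) cE cVH cΛ (T2Of_loc (one_le_of_two_le hLc) cE cVH cΛ ((Lc : ℝ) ^ (2 * (3 + 1))) cB Tc (hB_an1 (one_le_of_two_le hLc) hr) (hmix_an1 (one_le_of_two_le hLc) hr)) (hmix_an1 (one_le_of_two_le hLc) hr)) j).S))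
        (limTabOf fun j => unitW (sfStep Lc j) (smStep 3 Lc j) (WbalOf 3 Lc cE cVH cΛ (T2Of 3 Lc cE cVH cΛ ((Lc : ℝ) ^ (2 * (3 + 1))) cB Tc (vh₂SAt (toSite r) Lc) (mixFFAt (toSite r) Lc)) (mixFFAt (toSite r) Lc) j))) μ ν := by
  rw [← lim_eq_closedForm_pinned hLc hr cE cVH cΛ cB Tc μ ν]
  exact exists_numeral_iff_lim_nonneg hLc hr cE cVH cΛ cB Tc μ ν

/-- [folklore] **`N_eff` IN CLOSED FORM**: for `0 ≤ N`, `D1Drift Lc (JsBalAn1 …) N μ ν ↔ 0 ≤ M∞ ∧ N = √(12π²·M∞ ∕ (11·log Lc))` — the binder's single free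
parameter at the pinned literal is an explicit functional of the constructed limit primitives (`D1PinnedNumeral.d1Drift_pinned_iff_eq_sqrt` across the bridge). -/
theorem d1Drift_pinned_iff_eq_sqrt_closedForm (hLc : 2 ≤ Lc) (hr : r ∈ box (3 + 1) Lc) (cE cVH cΛ cB : ℝ)
    (Tc : Fin 4 → Fin 4 → Fin 4 → Fin 4 → ℝ) (μ ν : Fin 4) {N : ℝ} (hN : 0 ≤ N) :
    D1Drift Lc (JsBalAn1 (one_le_of_two_le hLc) hr cE cVH cΛ ((Lc : ℝ) ^ (2 * (3 + 1))) cB Tc) N μ ν ↔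
      0 ≤ B12Beta.secondMoment (hessKer (axDressK Lc (limMKerOf fun j => unitK (sfStep Lc j) (smStep 3 Lc j) (KInvStep (d := 3) Lc j)))
        (axVertexOfK (limMKerOf fun j => unitK (sfStep Lc j) (smStep 3 Lc j) (KInvStep (d := 3) Lc j)) Lc
          (limStOf fun j => unitS (sfStep Lc j) (smStep 3 Lc j) (JsBal0Of (one_le_of_two_le hLc) cE cVH cΛ (WbalOf 3 Lc cE cVH cΛ (T2Of 3 Lc cE cVH cΛ ((Lc : ℝ) ^ (2 * (3 + 1))) cB Tc (vh₂SAt (toSite r) Lc) (mixFFAt (toSite r) Lc)) (mixFFAt (toSite r) Lc))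
            (CwOf (one_le_of_two_le hLc) cE cVH cΛ (T2Of_loc (one_le_of_two_le hLc) cE cVH cΛ ((Lc : ℝ) ^ (2 * (3 + 1))) cB Tc (hB_an1 (one_le_of_two_le hLc) hr) (hmix_an1 (one_le_of_two_le hLc) hr)) (hmix_an1 (one_le_of_two_le hLc) hr)) (δwOf (one_le_of_two_le hLc) cE cVH cΛ (T2Of_loc (one_le_of_two_le hLc) cE cVH cΛ ((Lc : ℝ) ^ (2 * (3 + 1))) cB Tc (hB_an1 (one_le_of_two_le hLc) hr) (hmix_an1 (one_le_of_two_le hLc) hr)) (hmix_an1 (one_le_of_two_le hLc) hr))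
            (δwOf_pos (one_le_of_two_le hLc) cE cVH cΛ (T2Of_loc (one_le_of_two_le hLc) cE cVH cΛ ((Lc : ℝ) ^ (2 * (3 + 1))) cB Tc (hB_an1 (one_le_of_two_le hLc) hr) (hmix_an1 (one_le_of_two_le hLc) hr)) (hmix_an1 (one_le_of_two_le hLc) hr)) (WbalOf_loc₂ (one_le_of_two_le hLc) cE cVH cΛ (T2Of_loc (one_le_of_two_le hLc) cE cVH cΛ ((Lc : ℝ) ^ (2 * (3 + 1))) cB Tc (hB_an1 (one_le_of_two_le hLc) hr) (hmix_an1 (one_le_of_two_le hLc) hr)) (hmix_an1 (one_le_of_two_le hLc) hr)) j).S))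
        (limTabOf fun j => unitW (sfStep Lc j) (smStep 3 Lc j) (WbalOf 3 Lc cE cVH cΛ (T2Of 3 Lc cE cVH cΛ ((Lc : ℝ) ^ (2 * (3 + 1))) cB Tc (vh₂SAt (toSite r) Lc) (mixFFAt (toSite r) Lc)) (mixFFAt (toSite r) Lc) j))) μ ν ∧
        N = Real.sqrt (12 * π ^ 2 *
          B12Beta.secondMoment (hessKer (axDressK Lc (limMKerOf fun j => unitK (sfStep Lc j) (smStep 3 Lc j) (KInvStep (d := 3) Lc j)))
            (axVertexOfK (limMKerOf fun j => unitK (sfStep Lc j) (smStep 3 Lc j) (KInvStep (d := 3) Lc j)) Lc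
              (limStOf fun j => unitS (sfStep Lc j) (smStep 3 Lc j) (JsBal0Of (one_le_of_two_le hLc) cE cVH cΛ (WbalOf 3 Lc cE cVH cΛ (T2Of 3 Lc cE cVH cΛ ((Lc : ℝ) ^ (2 * (3 + 1))) cB Tc (vh₂SAt (toSite r) Lc) (mixFFAt (toSite r) Lc)) (mixFFAt (toSite r) Lc))
                (CwOf (one_le_of_two_le hLc) cE cVH cΛ (T2Of_loc (one_le_of_two_le hLc) cE cVH cΛ ((Lc : ℝ) ^ (2 * (3 + 1))) cB Tc (hB_an1 (one_le_of_two_le hLc) hr) (hmix_an1 (one_le_of_two_le hLc) hr)) (hmix_an1 (one_le_of_two_le hLc) hr)) (δwOf (one_le_of_two_le hLc) cE cVH cΛ (T2Of_loc (one_le_of_two_le hLc) cE cVH cΛ ((Lc : ℝ) ^ (2 * (3 + 1))) cB Tc (hB_an1 (one_le_of_two_le hLc) hr) (hmix_an1 (one_le_of_two_le hLc) hr)) (hmix_an1 (one_le_of_two_le hLc) hr))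
                (δwOf_pos (one_le_of_two_le hLc) cE cVH cΛ (T2Of_loc (one_le_of_two_le hLc) cE cVH cΛ ((Lc : ℝ) ^ (2 * (3 + 1))) cB Tc (hB_an1 (one_le_of_two_le hLc) hr) (hmix_an1 (one_le_of_two_le hLc) hr)) (hmix_an1 (one_le_of_two_le hLc) hr)) (WbalOf_loc₂ (one_le_of_two_le hLc) cE cVH cΛ (T2Of_loc (one_le_of_two_le hLc) cE cVH cΛ ((Lc : ℝ) ^ (2 * (3 + 1))) cB Tc (hB_an1 (one_le_of_two_le hLc) hr) (hmix_an1 (one_le_of_two_le hLc) hr)) (hmix_an1 (one_le_of_two_le hLc) hr)) j).S))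
            (limTabOf fun j => unitW (sfStep Lc j) (smStep 3 Lc j) (WbalOf 3 Lc cE cVH cΛ (T2Of 3 Lc cE cVH cΛ ((Lc : ℝ) ^ (2 * (3 + 1))) cB Tc (vh₂SAt (toSite r) Lc) (mixFFAt (toSite r) Lc)) (mixFFAt (toSite r) Lc) j))) μ ν / (11 * Real.log Lc)) := by
  rw [← lim_eq_closedForm_pinned hLc hr cE cVH cΛ cB Tc μ ν]
  exact d1Drift_pinned_iff_eq_sqrt hLc hr cE cVH cΛ cB Tc μ ν hN

/-- [folklore] **UNIQUENESS OF THE NONNEGATIVE NUMERAL GIVEN `0 ≤ M∞`** (`D1PinnedNumeral.existsUnique_numeral_of_lim_nonneg` across the bridge). -/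
theorem existsUnique_numeral_of_closedForm_nonneg (hLc : 2 ≤ Lc) (hr : r ∈ box (3 + 1) Lc) (cE cVH cΛ cB : ℝ)
    (Tc : Fin 4 → Fin 4 → Fin 4 → Fin 4 → ℝ) (μ ν : Fin 4)
    (hM : 0 ≤ B12Beta.secondMoment (hessKer (axDressK Lc (limMKerOf fun j => unitK (sfStep Lc j) (smStep 3 Lc j) (KInvStep (d := 3) Lc j)))
      (axVertexOfK (limMKerOf fun j => unitK (sfStep Lc j) (smStep 3 Lc j) (KInvStep (d := 3) Lc j)) Lc
        (limStOf fun j => unitS (sfStep Lc j) (smStep 3 Lc j) (JsBal0Of (one_le_of_two_le hLc) cE cVH cΛ (WbalOf 3 Lc cE cVH cΛ (T2Of 3 Lc cE cVH cΛ ((Lc : ℝ) ^ (2 * (3 + 1))) cB Tc (vh₂SAt (toSite r) Lc) (mixFFAt (toSite r) Lc)) (mixFFAt (toSite r) Lc))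
          (CwOf (one_le_of_two_le hLc) cE cVH cΛ (T2Of_loc (one_le_of_two_le hLc) cE cVH cΛ ((Lc : ℝ) ^ (2 * (3 + 1))) cB Tc (hB_an1 (one_le_of_two_le hLc) hr) (hmix_an1 (one_le_of_two_le hLc) hr)) (hmix_an1 (one_le_of_two_le hLc) hr)) (δwOf (one_le_of_two_le hLc) cE cVH cΛ (T2Of_loc (one_le_of_two_le hLc) cE cVH cΛ ((Lc : ℝ) ^ (2 * (3 + 1))) cB Tc (hB_an1 (one_le_of_two_le hLc) hr) (hmix_an1 (one_le_of_two_le hLc) hr)) (hmix_an1 (one_le_of_two_le hLc) hr))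
          (δwOf_pos (one_le_of_two_le hLc) cE cVH cΛ (T2Of_loc (one_le_of_two_le hLc) cE cVH cΛ ((Lc : ℝ) ^ (2 * (3 + 1))) cB Tc (hB_an1 (one_le_of_two_le hLc) hr) (hmix_an1 (one_le_of_two_le hLc) hr)) (hmix_an1 (one_le_of_two_le hLc) hr)) (WbalOf_loc₂ (one_le_of_two_le hLc) cE cVH cΛ (T2Of_loc (one_le_of_two_le hLc) cE cVH cΛ ((Lc : ℝ) ^ (2 * (3 + 1))) cB Tc (hB_an1 (one_le_of_two_le hLc) hr) (hmix_an1 (one_le_of_two_le hLc) hr)) (hmix_an1 (one_le_of_two_le hLc) hr)) j).S))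
      (limTabOf fun j => unitW (sfStep Lc j) (smStep 3 Lc j) (WbalOf 3 Lc cE cVH cΛ (T2Of 3 Lc cE cVH cΛ ((Lc : ℝ) ^ (2 * (3 + 1))) cB Tc (vh₂SAt (toSite r) Lc) (mixFFAt (toSite r) Lc)) (mixFFAt (toSite r) Lc) j))) μ ν) :
    ∃! N : ℝ, 0 ≤ N ∧ D1Drift Lc (JsBalAn1 (one_le_of_two_le hLc) hr cE cVH cΛ ((Lc : ℝ) ^ (2 * (3 + 1))) cB Tc) N μ ν :=
  existsUnique_numeral_of_lim_nonneg hLc hr cE cVH cΛ cB Tc μ ν ((lim_eq_closedForm_pinned hLc hr cE cVH cΛ cB Tc μ ν).symm ▸ hM)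

/-- [folklore] **THE END's β⁰-SIDE BIT ON `M∞`**: `(∃ N, 0 < N ∧ D1Drift Lc (JsBalAn1 …) N μ ν) ↔ 0 < M∞` — «(D1) for SOME positive numeral» is the strict sign
of ONE closed-form limit-kernel second moment (`D1PinnedNumeral.exists_pos_numeral_iff_lim_pos` across the bridge). -/
theorem exists_pos_numeral_iff_closedForm_pos (hLc : 2 ≤ Lc) (hr : r ∈ box (3 + 1) Lc) (cE cVH cΛ cB : ℝ)
    (Tc : Fin 4 → Fin 4 → Fin 4 → Fin 4 → ℝ) (μ ν : Fin 4) :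
    (∃ N : ℝ, 0 < N ∧ D1Drift Lc (JsBalAn1 (one_le_of_two_le hLc) hr cE cVH cΛ ((Lc : ℝ) ^ (2 * (3 + 1))) cB Tc) N μ ν) ↔
      0 < B12Beta.secondMoment (hessKer (axDressK Lc (limMKerOf fun j => unitK (sfStep Lc j) (smStep 3 Lc j) (KInvStep (d := 3) Lc j)))
        (axVertexOfK (limMKerOf fun j => unitK (sfStep Lc j) (smStep 3 Lc j) (KInvStep (d := 3) Lc j)) Lc
          (limStOf fun j => unitS (sfStep Lc j) (smStep 3 Lc j) (JsBal0Of (one_le_of_two_le hLc) cE cVH cΛ (WbalOf 3 Lc cE cVH cΛ (T2Of 3 Lc cE cVH cΛ ((Lc : ℝ) ^ (2 * (3 + 1))) cB Tc (vh₂SAt (toSite r) Lc) (mixFFAt (toSite r) Lc)) (mixFFAt (toSite r) Lc))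
            (CwOf (one_le_of_two_le hLc) cE cVH cΛ (T2Of_loc (one_le_of_two_le hLc) cE cVH cΛ ((Lc : ℝ) ^ (2 * (3 + 1))) cB Tc (hB_an1 (one_le_of_two_le hLc) hr) (hmix_an1 (one_le_of_two_le hLc) hr)) (hmix_an1 (one_le_of_two_le hLc) hr)) (δwOf (one_le_of_two_le hLc) cE cVH cΛ (T2Of_loc (one_le_of_two_le hLc) cE cVH cΛ ((Lc : ℝ) ^ (2 * (3 + 1))) cB Tc (hB_an1 (one_le_of_two_le hLc) hr) (hmix_an1 (one_le_of_two_le hLc) hr)) (hmix_an1 (one_le_of_two_le hLc) hr))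
            (δwOf_pos (one_le_of_two_le hLc) cE cVH cΛ (T2Of_loc (one_le_of_two_le hLc) cE cVH cΛ ((Lc : ℝ) ^ (2 * (3 + 1))) cB Tc (hB_an1 (one_le_of_two_le hLc) hr) (hmix_an1 (one_le_of_two_le hLc) hr)) (hmix_an1 (one_le_of_two_le hLc) hr)) (WbalOf_loc₂ (one_le_of_two_le hLc) cE cVH cΛ (T2Of_loc (one_le_of_two_le hLc) cE cVH cΛ ((Lc : ℝ) ^ (2 * (3 + 1))) cB Tc (hB_an1 (one_le_of_two_le hLc) hr) (hmix_an1 (one_le_of_two_le hLc) hr)) (hmix_an1 (one_le_of_two_le hLc) hr)) j).S))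
        (limTabOf fun j => unitW (sfStep Lc j) (smStep 3 Lc j) (WbalOf 3 Lc cE cVH cΛ (T2Of 3 Lc cE cVH cΛ ((Lc : ℝ) ^ (2 * (3 + 1))) cB Tc (vh₂SAt (toSite r) Lc) (mixFFAt (toSite r) Lc)) (mixFFAt (toSite r) Lc) j))) μ ν := by
  rw [← lim_eq_closedForm_pinned hLc hr cE cVH cΛ cB Tc μ ν]
  exact exists_pos_numeral_iff_lim_pos hLc hr cE cVH cΛ cB Tc μ ν

/-! ## §2 At the CENTRED root — road BF-x's literal `JsBalAn1Ctr` -/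

/-- [folklore] **THE END's β⁰-SIDE BIT ON `M∞` AT THE CENTRED ROOT**: `(∃ N, 0 < N ∧ D1Drift Lc (JsBalAn1Ctr …) N μ ν) ↔ 0 < M∞` — §1 at `hr := ctrOff_mem_box`
(`JsBalAn1Ctr … = JsBalAn1 … (ctrOff_mem_box …)` by `rfl`). -/
theorem exists_pos_numeral_iff_closedForm_pos_ctr (hLc : 2 ≤ Lc) (cE cVH cΛ cB : ℝ) (Tc : Fin 4 → Fin 4 → Fin 4 → Fin 4 → ℝ) (μ ν : Fin 4) :
    (∃ N : ℝ, 0 < N ∧ D1Drift Lc (JsBalAn1Ctr (one_le_of_two_le hLc) cE cVH cΛ ((Lc : ℝ) ^ (2 * (3 + 1))) cB Tc) N μ ν) ↔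
      0 < B12Beta.secondMoment (hessKer (axDressK Lc (limMKerOf fun j => unitK (sfStep Lc j) (smStep 3 Lc j) (KInvStep (d := 3) Lc j)))
        (axVertexOfK (limMKerOf fun j => unitK (sfStep Lc j) (smStep 3 Lc j) (KInvStep (d := 3) Lc j)) Lc
          (limStOf fun j => unitS (sfStep Lc j) (smStep 3 Lc j) (JsBal0Of (one_le_of_two_le hLc) cE cVH cΛ (WbalOf 3 Lc cE cVH cΛ (T2Of 3 Lc cE cVH cΛ ((Lc : ℝ) ^ (2 * (3 + 1))) cB Tc (vh₂SAt (toSite (ctrOff (3 + 1) Lc)) Lc) (mixFFAt (toSite (ctrOff (3 + 1) Lc)) Lc)) (mixFFAt (toSite (ctrOff (3 + 1) Lc)) Lc))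
            (CwOf (one_le_of_two_le hLc) cE cVH cΛ (T2Of_loc (one_le_of_two_le hLc) cE cVH cΛ ((Lc : ℝ) ^ (2 * (3 + 1))) cB Tc (hB_an1 (one_le_of_two_le hLc) (ctrOff_mem_box (one_le_of_two_le hLc))) (hmix_an1 (one_le_of_two_le hLc) (ctrOff_mem_box (one_le_of_two_le hLc)))) (hmix_an1 (one_le_of_two_le hLc) (ctrOff_mem_box (one_le_of_two_le hLc)))) (δwOf (one_le_of_two_le hLc) cE cVH cΛ (T2Of_loc (one_le_of_two_le hLc) cE cVH cΛ ((Lc : ℝ) ^ (2 * (3 + 1))) cB Tc (hB_an1 (one_le_of_two_le hLc) (ctrOff_mem_box (one_le_of_two_le hLc))) (hmix_an1 (one_le_of_two_le hLc) (ctrOff_mem_box (one_le_of_two_le hLc)))) (hmix_an1 (one_le_of_two_le hLc) (ctrOff_mem_box (one_le_of_two_le hLc))))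
            (δwOf_pos (one_le_of_two_le hLc) cE cVH cΛ (T2Of_loc (one_le_of_two_le hLc) cE cVH cΛ ((Lc : ℝ) ^ (2 * (3 + 1))) cB Tc (hB_an1 (one_le_of_two_le hLc) (ctrOff_mem_box (one_le_of_two_le hLc))) (hmix_an1 (one_le_of_two_le hLc) (ctrOff_mem_box (one_le_of_two_le hLc)))) (hmix_an1 (one_le_of_two_le hLc) (ctrOff_mem_box (one_le_of_two_le hLc)))) (WbalOf_loc₂ (one_le_of_two_le hLc) cE cVH cΛ (T2Of_loc (one_le_of_two_le hLc) cE cVH cΛ ((Lc : ℝ) ^ (2 * (3 + 1))) cB Tc (hB_an1 (one_le_of_two_le hLc) (ctrOff_mem_box (one_le_of_two_le hLc))) (hmix_an1 (one_le_of_two_le hLc) (ctrOff_mem_box (one_le_of_two_le hLc)))) (hmix_an1 (one_le_of_two_le hLc) (ctrOff_mem_box (one_le_of_two_le hLc)))) j).S))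
        (limTabOf fun j => unitW (sfStep Lc j) (smStep 3 Lc j) (WbalOf 3 Lc cE cVH cΛ (T2Of 3 Lc cE cVH cΛ ((Lc : ℝ) ^ (2 * (3 + 1))) cB Tc (vh₂SAt (toSite (ctrOff (3 + 1) Lc)) Lc) (mixFFAt (toSite (ctrOff (3 + 1) Lc)) Lc)) (mixFFAt (toSite (ctrOff (3 + 1) Lc)) Lc) j))) μ ν :=
  exists_pos_numeral_iff_closedForm_pos hLc (ctrOff_mem_box (one_le_of_two_le hLc)) cE cVH cΛ cB Tc μ ν

/-! ## §3 The limit on its two words: tadpole half + bubble half -/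

/-- [folklore] **`lim β⁰ = M∞ᵂ + M∞ˢ` AT THE PINNED LITERAL, HYPOTHESIS-FREE**: the number the END reads (`CauchyRate.lim (j ↦ β⁰_j)`) is the second moment of the
TADPOLE half `hessKer A∞ 0 W∞` plus that of the BUBBLE half `hessKer A∞ V∞ 0` (`A∞ = axDressK Lc K∞`, `V∞ = axVertexOfK K∞ Lc S∞`) — the bridge
`D1PinnedLimitClosedForm.lim_eq_closedForm_pinned` followed by `D1PinnedClosedFormHalves.closedForm_eq_halves_pinned`.  Neither half evaluated or signed. -/
theorem lim_eq_halves_pinned (hLc : 2 ≤ Lc) (hr : r ∈ box (3 + 1) Lc) (cE cVH cΛ cB : ℝ)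
    (Tc : Fin 4 → Fin 4 → Fin 4 → Fin 4 → ℝ) (μ ν : Fin 4) :
    CauchyRate.lim (fun j => B12Beta.secondMoment (TbalOf Lc (JsBalAn1 (one_le_of_two_le hLc) hr cE cVH cΛ ((Lc : ℝ) ^ (2 * (3 + 1))) cB Tc) j) μ ν) =
      B12Beta.secondMoment (hessKer (axDressK Lc (limMKerOf fun j => unitK (sfStep Lc j) (smStep 3 Lc j) (KInvStep (d := 3) Lc j))) 0
        (limTabOf fun j => unitW (sfStep Lc j) (smStep 3 Lc j) (WbalOf 3 Lc cE cVH cΛ (T2Of 3 Lc cE cVH cΛ ((Lc : ℝ) ^ (2 * (3 + 1))) cB Tc (vh₂SAt (toSite r) Lc) (mixFFAt (toSite r) Lc)) (mixFFAt (toSite r) Lc) j))) μ ν +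
      B12Beta.secondMoment (hessKer (axDressK Lc (limMKerOf fun j => unitK (sfStep Lc j) (smStep 3 Lc j) (KInvStep (d := 3) Lc j)))
        (axVertexOfK (limMKerOf fun j => unitK (sfStep Lc j) (smStep 3 Lc j) (KInvStep (d := 3) Lc j)) Lc
          (limStOf fun j => unitS (sfStep Lc j) (smStep 3 Lc j) (JsBal0Of (one_le_of_two_le hLc) cE cVH cΛ (WbalOf 3 Lc cE cVH cΛ (T2Of 3 Lc cE cVH cΛ ((Lc : ℝ) ^ (2 * (3 + 1))) cB Tc (vh₂SAt (toSite r) Lc) (mixFFAt (toSite r) Lc)) (mixFFAt (toSite r) Lc))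
            (CwOf (one_le_of_two_le hLc) cE cVH cΛ (T2Of_loc (one_le_of_two_le hLc) cE cVH cΛ ((Lc : ℝ) ^ (2 * (3 + 1))) cB Tc (hB_an1 (one_le_of_two_le hLc) hr) (hmix_an1 (one_le_of_two_le hLc) hr)) (hmix_an1 (one_le_of_two_le hLc) hr)) (δwOf (one_le_of_two_le hLc) cE cVH cΛ (T2Of_loc (one_le_of_two_le hLc) cE cVH cΛ ((Lc : ℝ) ^ (2 * (3 + 1))) cB Tc (hB_an1 (one_le_of_two_le hLc) hr) (hmix_an1 (one_le_of_two_le hLc) hr)) (hmix_an1 (one_le_of_two_le hLc) hr))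
            (δwOf_pos (one_le_of_two_le hLc) cE cVH cΛ (T2Of_loc (one_le_of_two_le hLc) cE cVH cΛ ((Lc : ℝ) ^ (2 * (3 + 1))) cB Tc (hB_an1 (one_le_of_two_le hLc) hr) (hmix_an1 (one_le_of_two_le hLc) hr)) (hmix_an1 (one_le_of_two_le hLc) hr)) (WbalOf_loc₂ (one_le_of_two_le hLc) cE cVH cΛ (T2Of_loc (one_le_of_two_le hLc) cE cVH cΛ ((Lc : ℝ) ^ (2 * (3 + 1))) cB Tc (hB_an1 (one_le_of_two_le hLc) hr) (hmix_an1 (one_le_of_two_le hLc) hr)) (hmix_an1 (one_le_of_two_le hLc) hr)) j).S))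
        0) μ ν :=
  (lim_eq_closedForm_pinned hLc hr cE cVH cΛ cB Tc μ ν).trans (closedForm_eq_halves_pinned hLc hr cE cVH cΛ cB Tc μ ν)

end Summit.QuantumFields.BalabanUV.Gaps.D1PinnedNumeralClosedForm

end
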